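import Summits.AnomalousDissipation.AnomalousDissipation.Theses.MarginalStabilityChain
import Summits.AnomalousDissipation.AnomalousDissipation.Theorems.MarginalStabilityChainBurgersLayerKH
import Summits.AnomalousDissipation.AnomalousDissipation.Theorems.MarginalStabilityChainStretchedVortexRows
import HarnessLib

/-!
# The crux `MarginalStabilityChain.ChainRealisation` after BOTH dischargeable antecedents landed:
# it is exactly `StrainedLayerLaw → ChainThesis`

Negative / structural knowledge for crux stmt-AnomalousDissipation-14249 (line lead c2, 2026-08-16), sharpening
`Theorems/ChainRealisation/Negative/KillShape.lean` (which used only antecedent (3)).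

The crux is the curried implication
`ChainRealisation : StrainedLayerLaw → BurgersLayerKH → StretchedVortexRows → ChainThesis`.
Two of its three antecedents are now THEOREMS of the tree:

* (3) `BurgersLayerKH` (stmt 3008) — `Theorems.BurgersLayerKH.Sheet.burgersLayerKH_proof`;
* (4) `StretchedVortexRows` (stmt 3009) — `Theorems.MarginalStabilityChainStretchedVortexRows.PotentialFlow.StretchedVortexRows_of`
  (closed 2026-08-16 through the `ℝ≥0∞` loophole of the statement as filed: an irrotational member of the stretched
  two-dimensional class with an essential singularity at `y = ±∞` has `layerDissipation = ⊤ ≥ ofReal (c·min(L,1))`).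

Consequences, kernel-checked below (classical propositional logic on the curried implication; no statement of the
route is asserted — every theorem is an equivalence, or has `ChainThesis` / `¬ StrainedLayerLaw` / `StrainedLayerLaw` as
hypothesis):

* `chainRealisation_iff_imp` — `ChainRealisation ↔ (StrainedLayerLaw → ChainThesis)`: vacuity door 2 of
  `KillShape.chainRealisation_iff_or` is SHUT FOR GOOD; the crux is the two-term implication "single-layer law ⇒ zeroth
  law (complete classical class, one steady force)".
* `chainRealisation_iff_not_or` — the two remaining doors: `¬ StrainedLayerLaw` (vacuity door 1: needs, for EVERY admissible
  perturbation `θ` of the Burgers layer, a TAME global classical solution of the stretched class with small liminf-mean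
  dissipation — global well-posedness plus laminarisation, or a finite-dissipation ghost; the standing file
  `Cruxes/StrainedLayerLaw/Disproof.lean` reports none) or `ChainThesis` itself (stmt 3005, the route target; Bruè–De Lellis
  2023 Questions 2.1–2.2, open).
* `not_chainRealisation_iff` — a KILL now costs exactly a proof of `StrainedLayerLaw` (stmt 3007, open) AND `¬ ChainThesis`.
* `chainRealisation_iff_chainThesis_of` — granted the single-layer law, the crux IS the target; in particular every line
  whose residual implies `ChainThesis` (line `SketchIdeator2`: `ContrastFamily ⇒ ChainThesis` by the landed
  `…ForwardPhase.chainThesis_of_forwardFamilyZM_holds` and the budget step) proves nothing less than the target.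
* `chainRealisation_of_chainThesis` — the one-line closing move available the moment stmt 3005 lands.
-/

set_option linter.dupNamespace false

namespace Summit.AnomalousDissipation.AnomalousDissipation.Theorems.ChainRealisation.Reduction

open Summit.AnomalousDissipation.AnomalousDissipation.Theses.MarginalStabilityChain
open Summit.AnomalousDissipation.AnomalousDissipation.Theorems.BurgersLayerKH.Sheet (burgersLayerKH_proof)
open Summit.AnomalousDissipation.AnomalousDissipation.Theorems.MarginalStabilityChainStretchedVortexRows.PotentialFlow
  (StretchedVortexRows_of)

/-- **REDUCTION BY BOTH LANDED ANTECEDENTS.** With `BurgersLayerKH` (3008) and `StretchedVortexRows` (3009) theorems of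
the tree, the crux `ChainRealisation` is equivalent to `StrainedLayerLaw → ChainThesis`. [folklore] -/
theorem chainRealisation_iff_imp : ChainRealisation ↔ (StrainedLayerLaw → ChainThesis) :=
  ⟨fun h h2 => h h2 burgersLayerKH_proof StretchedVortexRows_of, fun h h2 _ _ => h h2⟩

/-- **The honest door.** Every proof of the route target `ChainThesis` (stmt 3005) closes the crux in one line; this is
the closing move to replay when 3005 lands. [folklore] -/
theorem chainRealisation_of_chainThesis (h : ChainThesis) : ChainRealisation := fun _ _ _ => h

/-- **The only vacuity door left.** A refutation of the single-layer law `StrainedLayerLaw` (stmt 3007) closes the crux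
vacuously (and closes the route at its unit cell). [folklore] -/
theorem chainRealisation_of_not_strainedLayerLaw (h : ¬ StrainedLayerLaw) : ChainRealisation :=
  fun h2 _ _ => absurd h2 h

/-- **THE TWO DOORS.** The crux holds iff the single-layer law fails or the target holds. [folklore] -/
theorem chainRealisation_iff_not_or : ChainRealisation ↔ (¬ StrainedLayerLaw ∨ ChainThesis) := by
  rw [chainRealisation_iff_imp]
  exact imp_iff_not_or

/-- **EXACT SHAPE OF A KILL, sharpened.** `¬ ChainRealisation` iff the single-layer law holds AND the target fails:
a refutation costs a proof of stmt 3007 plus the negative zeroth law in the complete classical class. [folklore] -/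
theorem not_chainRealisation_iff : ¬ ChainRealisation ↔ (StrainedLayerLaw ∧ ¬ ChainThesis) := by
  rw [chainRealisation_iff_imp, Classical.not_imp]

/-- **Granted the single-layer law, the crux IS the target** (so no line can be easier than stmt 3005 unless it refutes
stmt 3007). [folklore] -/
theorem chainRealisation_iff_chainThesis_of (h2 : StrainedLayerLaw) : ChainRealisation ↔ ChainThesis :=
  ⟨fun h => h h2 burgersLayerKH_proof StretchedVortexRows_of, fun h _ _ _ => h⟩

end Summit.AnomalousDissipation.AnomalousDissipation.Theorems.ChainRealisation.Reduction
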